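import Summits.CriticalPhenomena.SAWScalingLimit.Theses.SAWSteinDefect
import Literature.Probability.RandomPlanarGeometry.ExcursionRestrictionHarmonic
import Literature.Probability.RandomPlanarGeometry.HullSubdomainPullback
import Literature.Probability.RandomPlanarGeometry.JordanDomainProofs

/-!
# Birth skeleton (`Lines/birth.lean`, BC3) for the crux `ExcursionInitialValue` of route `SAWSteinDefect`
(item stmt-CriticalPhenomena-7519, rank 4)

Crux (`Summit.CriticalPhenomena.SAWScalingLimit.Theses.SAWSteinDefect.ExcursionInitialValue`): for a
Dobrushin domain `(D; a, b)`, a hull subdomain `D'` (same marked points, `D' = D` in balls around `a` and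
`b`), an endpoint approximation `(a_δ, b_δ)`, a chordal uniformizer `φ : ℍ → D`, the pulled-back hull
`A = φ.pullbackHull D'` and restriction data `(Φ, d = Φ'_A(0))`, the initial lattice excursion-avoidance
ratio `q_0(δ) = H'([a_δ]; a_δ) / H([a_δ]; a_δ)` — the probability that simple random walk from `a_δ`,
conditioned to reach `b_δ` before leaving `Ω_δ` or returning to `a_δ`, has its polyline in `closure D'` —
tends to `d` as `δ → 0+`.

## The line = the route's own two-layer plan for this crux, typed

Route header, TWO-LAYER PLAN: "ExcursionInitialValue ⇐ (uniform boundary Harnack for ratios of discrete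
harmonic functions near a and b, Chelkak2016) → (interior invariance principle for the h-transformed walk)
→ ExcursionInitialValue".  Write `ρ_δ(w) := H'([a_δ]; w) / H([a_δ]; w)` for the same ratio started from an
ARBITRARY vertex `w` (walks from `w` to `b_δ` avoiding `a_δ` after time 0, stopped at `b_δ`, weight
`4^{-|ω|}`); `q_0(δ) = ρ_δ(a_δ)`.  The proof splits into two genuinely different statements and one
in-tree theorem:

* `stub_interiorRatio` (INTERIOR IDENTIFICATION; L). For every point `x ∈ ℍ ∖ A` — i.e. every interior
  point `z = φ x` of `D'` — along the nearest-site approximation `w_δ = [φ x / δ]` the excursion mass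
  `H([a_δ]; w_δ)` is eventually positive and `ρ_δ(w_δ) → Im Φ_A(x) / Im x`, the probability that the
  Brownian excursion of `ℍ` started at `x` avoids `A` ([LSW03] proof of Prop. 4.1, first display; in tree
  the harmonic function `excursionRatio`).  Lattice content: the random walk from an interior point
  conditioned to exit at the boundary POINT `b_δ` (and to miss `a_δ`, a vanishing conditioning) converges
  to the Brownian `h`-process to `b` = `φ`(excursion to `∞`), in a topology seeing the closed event
  `{path ⊆ closure D'}`; the local lattice factor at `b_δ` CANCELS in the ratio because `D' = D` near `b`
  (Kozdron–Lawler 2005 Poisson-kernel/excursion convergence on grid domains; Yadin–Yehudayoff 2011 for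
  general planar domains; Chelkak–Wan 2021 §3 for rough boundaries).  This is where 'agree near b' is used.
* `stub_poleHarnack` (δ-UNIFORM BOUNDARY HARNACK AT THE POLE `a`; L, the HARDEST — it is the crux's own
  "why it might fail").  A pure lattice statement with no `φ, Φ, d`: for every `ε > 0` there is `r > 0` such
  that, eventually as `δ → 0+`, `|ρ_δ(w) − ρ_δ(a_δ)| < ε` for every vertex `w` with `δw ∈ B(a, r)` and
  `H([a_δ]; w) > 0`.  Both `H'` and `H` are positive discrete-harmonic off `{a_δ, b_δ}` for the SAME graph
  inside `B(a, ε₀)` (there `D' = D`, so the confinement is invisible), vanish on `∂Ω_δ ∩ B(a, ε₀)` and at the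
  puncture `a_δ` (at mesoscopic depth), and are fed only by far-away data; the claim is Hölder continuity of
  their ratio up to `a`, uniformly in `δ`, in a ROUGH Jordan domain (uniform local connectivity of Jordan
  domains tames fjords; Chelkak2016 toolbox, uniform over simply connected discrete domains; Kozdron–Lawler
  2005 only for grid domains with separated boundary points).  `ρ_δ(a_δ)` is the `H`-weighted average of
  `ρ_δ` over the neighbours of `a_δ`, so the pole itself is included at no cost.
* IN TREE (used by name in the glue, not a stub): `IsRestrictionMap.tendsto_im_div_im_nhdsWithin_zero` —
  `Im Φ_A(x)/Im x → Φ'_A(0) = d` as `x → 0` inside `ℍ ∖ A` ([LSW03] proof of Prop. 4.1, last display), for the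
  `*`-hull `A = φ.pullbackHull D'` (`IsStarHull.pullbackHull`, `JordanDomain.isSimplyConnected_holds`).

Composition `ExcursionInitialValue_of` (PROVED below, no `sorry`): given `ε`, take `r` from the pole
Harnack stub (`ε/3`); the filter `𝓝[ℍ ∖ A] 0` is non-trivial (`IsStarHull.zero_mem_closure_diff`), so
there is `x ∈ ℍ ∖ A` with `|Im Φ(x)/Im x − d| < ε/3` (tree theorem) and `φ x ∈ B(a, r/2)` (`φ → a` at `0`,
`IsChordalUniformizing`); by the interior stub, eventually `|ρ_δ(w_δ) − Im Φ(x)/Im x| < ε/3` and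
`H([a_δ]; w_δ) > 0`, and `δ w_δ ∈ B(a, r)` once `δ < r/2` (`dist_meshPoint_nearestSite_le`); the pole
Harnack stub then gives `|ρ_δ(a_δ) − ρ_δ(w_δ)| < ε/3`, whence `|q_0(δ) − d| < ε` eventually.

Disproof.lean: none exists for this crux (no `_false_without_` theorems, no landed `Negative/` lemmas;
`ledger crux ls stmt-CriticalPhenomena-7519`: no workfiles before this one).  Hypotheses honoured: the
ε-ball clause ('agree near a, b') is load-bearing in BOTH stubs (near `a` for the common graph of the pole
Harnack statement, near `b` for the cancellation of the local factor at `b_δ`); `IsEndpointApprox` feeds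
`b_δ → b`, `a_δ → a` and reachability (positivity of `H([a_δ]; a_δ)`, inside `stub_poleHarnack`); the
chordal normalisation of `φ` and `IsRestrictionMap Φ` pin the limit `Im Φ(x)/Im x` of the interior stub.

Sources: LawlerSchrammWerner2003Restriction (arXiv:math/0209343) Prop. 4.1 and its proof p. 16;
KozdronLawler2005 (EJP 10) Thm 1.1/§3 (Poisson kernel and excursion convergence on grid domains);
Yadin–Yehudayoff, Ann. Probab. 39 (2011) arXiv:0809.0792 (Poisson kernel ratios on planar graphs);
Chelkak2016 (Robust discrete complex analysis: a toolbox, Ann. Probab. 44) §3; Chelkak–Wan arXiv:1903.08045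
§3 (uniform estimates near rough boundaries); Kozdron2007Fomin §2 (discrete excursion Poisson kernel);
Lawler2006 (Laplacian-b walk / excursion vocabulary); Pommerenke1992 Thm 2.1 (Jordan boundary ⇔ uniform
local connectivity).
-/

noncomputable section

open scoped Topology Classical
open Filter Set
open UpperHalfPlane (upperHalfPlaneSet)
open Literature.Probability.RandomPlanarGeometry Literature.Probability.LatticeModels
open Summit.CriticalPhenomena.SAWScalingLimit.Theses.SAWSteinDefect (ExcursionInitialValue)

namespace Summit.CriticalPhenomena.SAWScalingLimit.Cruxes.ExcursionInitialValue.Birth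

/-! ## 0. The lattice objects of the crux, named -/

/-- The lattice excursion mass `H(S; w)` of the crux (its `let H`, with the domain `D`, the target leg `b`
and the mesh `δ` explicit): the `4^{-|ω|}`-mass of nearest-neighbour walks of `Ω_δ` from `w` to `b_δ` that
avoid the list `S` after time `0` and stop at `b_δ`. -/
def exMass (D : DobrushinDomain) (b : ℝ → Site 2) (δ : ℝ) (S : List (Site 2)) (w : Site 2) : ℝ :=
  ∑' ω : (discreteDomainGraph D.carrier δ).Walk w (b δ),
    if (∀ v ∈ ω.support.tail, v ∉ S) ∧ b δ ∉ ω.support.dropLast then (1 / 4 : ℝ) ^ ω.length else 0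

/-- The confined lattice excursion mass `H'(S; w)` of the crux (its `let H'`): the walks of `exMass` whose
polyline moreover stays in `closure D'`. -/
def exMassIn (D D' : DobrushinDomain) (b : ℝ → Site 2) (δ : ℝ) (S : List (Site 2)) (w : Site 2) : ℝ :=
  ∑' ω : (discreteDomainGraph D.carrier δ).Walk w (b δ),
    if (∀ v ∈ ω.support.tail, v ∉ S) ∧ b δ ∉ ω.support.dropLast ∧
        Set.range (ω.toCurve (meshPoint δ)) ⊆ closure D'.carrier then (1 / 4 : ℝ) ^ ω.length else 0

/-- The lattice excursion-avoidance ratio `ρ_δ(w) = H'([a_δ]; w) / H([a_δ]; w)` started from an arbitrary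
vertex `w` (the crux's `q_0(δ)` is `ρ_δ(a_δ)`). -/
def exRatio (D D' : DobrushinDomain) (a b : ℝ → Site 2) (δ : ℝ) (w : Site 2) : ℝ :=
  exMassIn D D' b δ [a δ] w / exMass D b δ [a δ] w

/-! ## 1. The statements of the line (named forms) -/

/-- **InteriorRatioLimit** (stub 1, L): interior identification of the lattice avoidance ratio with the
Brownian-excursion avoidance probability `Im Φ_A(x) / Im x`, along the nearest-site approximation of
`φ x`, for every `x ∈ ℍ ∖ A`; with eventual positivity of the excursion mass there.
[cite: LawlerSchrammWerner2003Restriction, proof of Prop. 4.1] [cite: KozdronLawler2005, Thm 1.1]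
[cite: arXiv:0809.0792] -/
def InteriorRatioLimit : Prop :=
  ∀ (D D' : DobrushinDomain) (a b : ℝ → Site 2), SAW.IsEndpointApprox D a b →
    D'.carrier ⊆ D.carrier → D'.pt 0 = D.pt 0 → D'.pt 1 = D.pt 1 →
    (∃ ε : ℝ, 0 < ε ∧ D'.carrier ∩ Metric.ball (D.pt 0) ε = D.carrier ∩ Metric.ball (D.pt 0) ε ∧
      D'.carrier ∩ Metric.ball (D.pt 1) ε = D.carrier ∩ Metric.ball (D.pt 1) ε) →
    ∀ (φ : ConformalEquiv upperHalfPlaneSet D.carrier), D.IsChordalUniformizing φ →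
    ∀ (Φ : ConformalEquiv (upperHalfPlaneSet \ φ.pullbackHull D') upperHalfPlaneSet),
    IsRestrictionMap (φ.pullbackHull D') Φ →
    ∀ x ∈ upperHalfPlaneSet \ φ.pullbackHull D',
      (∀ᶠ δ in 𝓝[>] (0 : ℝ), 0 < exMass D b δ [a δ] (nearestSite δ (φ x))) ∧
      Tendsto (fun δ => exRatio D D' a b δ (nearestSite δ (φ x))) (𝓝[>] 0) (𝓝 ((Φ x).im / x.im))

/-- **PoleHarnack** (stub 2, L, the hardest): `δ`-uniform vanishing oscillation of the lattice avoidance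
ratio at the pole `a`, over all vertices near `a` from which `b_δ` is reachable avoiding `a_δ`
(`H > 0`), the pole `a_δ` included.  No `φ`, `Φ`, `d`: a boundary Harnack principle for the ratio of two
positive discrete-harmonic functions vanishing on the same rough boundary portion and at the puncture
`a_δ`, uniformly in the mesh. [cite: Chelkak2016, §3] [cite: KozdronLawler2005, §3] [cite: arXiv:1903.08045, §3] -/
def PoleHarnack : Prop :=
  ∀ (D D' : DobrushinDomain) (a b : ℝ → Site 2), SAW.IsEndpointApprox D a b →
    D'.carrier ⊆ D.carrier → D'.pt 0 = D.pt 0 → D'.pt 1 = D.pt 1 →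
    (∃ ε : ℝ, 0 < ε ∧ D'.carrier ∩ Metric.ball (D.pt 0) ε = D.carrier ∩ Metric.ball (D.pt 0) ε ∧
      D'.carrier ∩ Metric.ball (D.pt 1) ε = D.carrier ∩ Metric.ball (D.pt 1) ε) →
    ∀ ε : ℝ, 0 < ε → ∃ r : ℝ, 0 < r ∧ ∀ᶠ δ in 𝓝[>] (0 : ℝ), ∀ w : Site 2,
      meshPoint δ w ∈ Metric.ball (D.pt 0) r → 0 < exMass D b δ [a δ] w →
      |exRatio D D' a b δ w - exRatio D D' a b δ (a δ)| < ε

/-! ## 2. Registered stubs (sorried; statements LITERAL over tree declarations, the crux's own `let H`,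
`let H'`) -/

/-- STUB 1 (L): interior identification (`InteriorRatioLimit`, literal). -/
theorem stub_interiorRatio :
    ∀ (D D' : DobrushinDomain) (a b : ℝ → Site 2),
    let H : ℝ → List (Site 2) → Site 2 → ℝ := fun δ S w =>
      ∑' ω : (discreteDomainGraph D.carrier δ).Walk w (b δ),
        if (∀ v ∈ ω.support.tail, v ∉ S) ∧ b δ ∉ ω.support.dropLast then (1 / 4 : ℝ) ^ ω.length else 0
    let H' : ℝ → List (Site 2) → Site 2 → ℝ := fun δ S w =>
      ∑' ω : (discreteDomainGraph D.carrier δ).Walk w (b δ),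
        if (∀ v ∈ ω.support.tail, v ∉ S) ∧ b δ ∉ ω.support.dropLast ∧
            Set.range (ω.toCurve (meshPoint δ)) ⊆ closure D'.carrier then (1 / 4 : ℝ) ^ ω.length else 0
    SAW.IsEndpointApprox D a b →
    D'.carrier ⊆ D.carrier → D'.pt 0 = D.pt 0 → D'.pt 1 = D.pt 1 →
    (∃ ε : ℝ, 0 < ε ∧ D'.carrier ∩ Metric.ball (D.pt 0) ε = D.carrier ∩ Metric.ball (D.pt 0) ε ∧
      D'.carrier ∩ Metric.ball (D.pt 1) ε = D.carrier ∩ Metric.ball (D.pt 1) ε) →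
    ∀ (φ : ConformalEquiv upperHalfPlaneSet D.carrier), D.IsChordalUniformizing φ →
    ∀ (Φ : ConformalEquiv (upperHalfPlaneSet \ φ.pullbackHull D') upperHalfPlaneSet),
    IsRestrictionMap (φ.pullbackHull D') Φ →
    ∀ x ∈ upperHalfPlaneSet \ φ.pullbackHull D',
      (∀ᶠ δ in 𝓝[>] (0 : ℝ), 0 < H δ [a δ] (nearestSite δ (φ x))) ∧
      Tendsto (fun δ => H' δ [a δ] (nearestSite δ (φ x)) / H δ [a δ] (nearestSite δ (φ x)))
        (𝓝[>] 0) (𝓝 ((Φ x).im / x.im)) := by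
  sorry

/-- STUB 2 (L, HARDEST): `δ`-uniform boundary Harnack at the pole (`PoleHarnack`, literal). -/
theorem stub_poleHarnack :
    ∀ (D D' : DobrushinDomain) (a b : ℝ → Site 2),
    let H : ℝ → List (Site 2) → Site 2 → ℝ := fun δ S w =>
      ∑' ω : (discreteDomainGraph D.carrier δ).Walk w (b δ),
        if (∀ v ∈ ω.support.tail, v ∉ S) ∧ b δ ∉ ω.support.dropLast then (1 / 4 : ℝ) ^ ω.length else 0
    let H' : ℝ → List (Site 2) → Site 2 → ℝ := fun δ S w =>
      ∑' ω : (discreteDomainGraph D.carrier δ).Walk w (b δ),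
        if (∀ v ∈ ω.support.tail, v ∉ S) ∧ b δ ∉ ω.support.dropLast ∧
            Set.range (ω.toCurve (meshPoint δ)) ⊆ closure D'.carrier then (1 / 4 : ℝ) ^ ω.length else 0
    SAW.IsEndpointApprox D a b →
    D'.carrier ⊆ D.carrier → D'.pt 0 = D.pt 0 → D'.pt 1 = D.pt 1 →
    (∃ ε : ℝ, 0 < ε ∧ D'.carrier ∩ Metric.ball (D.pt 0) ε = D.carrier ∩ Metric.ball (D.pt 0) ε ∧
      D'.carrier ∩ Metric.ball (D.pt 1) ε = D.carrier ∩ Metric.ball (D.pt 1) ε) →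
    ∀ ε : ℝ, 0 < ε → ∃ r : ℝ, 0 < r ∧ ∀ᶠ δ in 𝓝[>] (0 : ℝ), ∀ w : Site 2,
      meshPoint δ w ∈ Metric.ball (D.pt 0) r → 0 < H δ [a δ] w →
      |H' δ [a δ] w / H δ [a δ] w - H' δ [a δ] (a δ) / H δ [a δ] (a δ)| < ε := by
  sorry

/-! The `Registered.stub_*` aliases name the stub statements (hypotheses of `ExcursionInitialValue_of`). -/
namespace Registered

/-- Registered statement of `stub_interiorRatio`. -/
abbrev stub_interiorRatio : Prop := InteriorRatioLimit
/-- Registered statement of `stub_poleHarnack`. -/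
abbrev stub_poleHarnack : Prop := PoleHarnack

end Registered

/-! The literal stubs ARE the named statements of §1 (definitional unfolding of `exMass`, `exMassIn`,
`exRatio` against the crux's `let H`, `let H'`). -/
theorem interiorRatioLimit_holds : InteriorRatioLimit := stub_interiorRatio
theorem poleHarnack_holds : PoleHarnack := stub_poleHarnack
example : Registered.stub_interiorRatio := stub_interiorRatio
example : Registered.stub_poleHarnack := stub_poleHarnack

/-! ## 3. Glue (sorry-free) -/

/-- The inline hull hypotheses of the crux give the tree's `IsHullSubdomain` (ball agreement ⇒ the marked
points are off `closure (D ∖ D')`).  (Same lemma as in `Cruxes/AvoidanceLimit/Lines/birth.lean`.) -/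
theorem isHullSubdomain_of_ball {D D' : DobrushinDomain} (hsub : D'.carrier ⊆ D.carrier)
    (h0 : D'.pt 0 = D.pt 0) (h1 : D'.pt 1 = D.pt 1)
    (hball : ∃ ε : ℝ, 0 < ε ∧ D'.carrier ∩ Metric.ball (D.pt 0) ε = D.carrier ∩ Metric.ball (D.pt 0) ε ∧
      D'.carrier ∩ Metric.ball (D.pt 1) ε = D.carrier ∩ Metric.ball (D.pt 1) ε) :
    D.IsHullSubdomain D' := by
  obtain ⟨ε, hε, hb0, hb1⟩ := hball
  have key : ∀ p : ℂ, D'.carrier ∩ Metric.ball p ε = D.carrier ∩ Metric.ball p ε →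
      p ∉ closure (D.carrier \ D'.carrier) := by
    intro p hp hmem
    rw [mem_closure_iff_nhds] at hmem
    obtain ⟨z, hzb, hzD, hzD'⟩ := hmem (Metric.ball p ε) (Metric.ball_mem_nhds p hε)
    have hz : z ∈ D'.carrier ∩ Metric.ball p ε := by rw [hp]; exact ⟨hzD, hzb⟩
    exact hzD' hz.1
  exact ⟨hsub, h0, h1, key _ hb0, key _ hb1⟩

/-- **The pole limit from the two stubs (named forms) and the tree's `Im Φ/Im → Φ'(0)`**: the crux's
conclusion for the named ratio `exRatio`. -/
theorem tendsto_exRatio_pole (h1 : InteriorRatioLimit) (h2 : PoleHarnack)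
    (D D' : DobrushinDomain) (a b : ℝ → Site 2) (hab : SAW.IsEndpointApprox D a b)
    (hsub : D'.carrier ⊆ D.carrier) (hp0 : D'.pt 0 = D.pt 0) (hp1 : D'.pt 1 = D.pt 1)
    (hball : ∃ ε : ℝ, 0 < ε ∧ D'.carrier ∩ Metric.ball (D.pt 0) ε = D.carrier ∩ Metric.ball (D.pt 0) ε ∧
      D'.carrier ∩ Metric.ball (D.pt 1) ε = D.carrier ∩ Metric.ball (D.pt 1) ε)
    (φ : ConformalEquiv upperHalfPlaneSet D.carrier) (hφ : D.IsChordalUniformizing φ)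
    (Φ : ConformalEquiv (upperHalfPlaneSet \ φ.pullbackHull D') upperHalfPlaneSet) (d : ℝ)
    (hΦ : IsRestrictionMap (φ.pullbackHull D') Φ) (hd : HasRestrictionDeriv (φ.pullbackHull D') Φ d) :
    Tendsto (fun δ => exRatio D D' a b δ (a δ)) (𝓝[>] 0) (𝓝 d) := by
  rw [Metric.tendsto_nhds]
  intro ε hε
  have hε3 : 0 < ε / 3 := by positivity
  -- (1) pole Harnack with `ε/3`
  obtain ⟨r, hr, hH⟩ := h2 D D' a b hab hsub hp0 hp1 hball (ε / 3) hε3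
  -- (2) the pulled-back hull is a `*`-hull, so `0` is approachable inside `ℍ ∖ A`
  have hHull : D.IsHullSubdomain D' := isHullSubdomain_of_ball hsub hp0 hp1 hball
  have hA : IsStarHull (φ.pullbackHull D') :=
    IsStarHull.pullbackHull JordanDomain.isSimplyConnected_holds hφ hHull
  haveI : (𝓝[upperHalfPlaneSet \ φ.pullbackHull D'] (0 : ℂ)).NeBot :=
    mem_closure_iff_nhdsWithin_neBot.1 hA.zero_mem_closure_diff
  -- (3) the continuum limit at the pole (tree) and `φ → a` at `0`
  have hlim : Tendsto (fun z => (Φ z).im / z.im) (𝓝[upperHalfPlaneSet \ φ.pullbackHull D'] 0) (𝓝 d) :=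
    hΦ.tendsto_im_div_im_nhdsWithin_zero hA hd
  have hφ0 : Tendsto φ (𝓝[upperHalfPlaneSet \ φ.pullbackHull D'] 0) (𝓝 (D.pt 0)) :=
    hφ.1.mono_left (nhdsWithin_mono _ fun z hz => hz.1)
  have e1 : ∀ᶠ z in 𝓝[upperHalfPlaneSet \ φ.pullbackHull D'] 0, dist ((Φ z).im / z.im) d < ε / 3 :=
    Metric.tendsto_nhds.1 hlim _ hε3
  have e2 : ∀ᶠ z in 𝓝[upperHalfPlaneSet \ φ.pullbackHull D'] 0, φ z ∈ Metric.ball (D.pt 0) (r / 2) :=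
    hφ0 (Metric.ball_mem_nhds _ (by positivity))
  have e3 : ∀ᶠ z in 𝓝[upperHalfPlaneSet \ φ.pullbackHull D'] 0,
      z ∈ upperHalfPlaneSet \ φ.pullbackHull D' := eventually_mem_nhdsWithin
  obtain ⟨x, hx1, hx2, hx3⟩ := (e1.and (e2.and e3)).exists
  -- (4) interior stub at `x`
  obtain ⟨hpos, hconv⟩ := h1 D D' a b hab hsub hp0 hp1 hball φ hφ Φ hΦ x hx3
  have e4 : ∀ᶠ δ in 𝓝[>] (0 : ℝ),
      dist (exRatio D D' a b δ (nearestSite δ (φ x))) ((Φ x).im / x.im) < ε / 3 :=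
    Metric.tendsto_nhds.1 hconv _ hε3
  -- (5) eventually `0 < δ < r/2`, so the approximating site is in `B(a, r)`
  have e5 : ∀ᶠ δ in 𝓝[>] (0 : ℝ), δ < r / 2 :=
    mem_nhdsWithin_of_mem_nhds (Iio_mem_nhds (by positivity : (0 : ℝ) < r / 2))
  have e0 : ∀ᶠ δ in 𝓝[>] (0 : ℝ), 0 < δ := eventually_mem_nhdsWithin
  filter_upwards [hH, hpos, e4, e5, e0] with δ hHδ hposδ h4 h5 h0
  have hball' : meshPoint δ (nearestSite δ (φ x)) ∈ Metric.ball (D.pt 0) r := by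
    rw [Metric.mem_ball]
    have hx2' : dist (φ x) (D.pt 0) < r / 2 := Metric.mem_ball.1 hx2
    calc dist (meshPoint δ (nearestSite δ (φ x))) (D.pt 0)
        ≤ dist (meshPoint δ (nearestSite δ (φ x))) (φ x) + dist (φ x) (D.pt 0) := dist_triangle _ _ _
      _ ≤ δ + dist (φ x) (D.pt 0) := by
          gcongr
          exact dist_meshPoint_nearestSite_le h0 _
      _ < r / 2 + r / 2 := add_lt_add h5 hx2'
      _ = r := by ring
  have key := hHδ (nearestSite δ (φ x)) hball' hposδ
  rw [Real.dist_eq] at h4 hx1 ⊢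
  have t1 : |exRatio D D' a b δ (a δ) - exRatio D D' a b δ (nearestSite δ (φ x))| < ε / 3 := by
    rw [abs_sub_comm]; exact key
  calc |exRatio D D' a b δ (a δ) - d|
      ≤ |exRatio D D' a b δ (a δ) - exRatio D D' a b δ (nearestSite δ (φ x))| +
          |exRatio D D' a b δ (nearestSite δ (φ x)) - d| := abs_sub_le _ _ _
    _ ≤ |exRatio D D' a b δ (a δ) - exRatio D D' a b δ (nearestSite δ (φ x))| +
          (|exRatio D D' a b δ (nearestSite δ (φ x)) - (Φ x).im / x.im| + |(Φ x).im / x.im - d|) := by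
          gcongr
          exact abs_sub_le _ _ _
    _ < ε / 3 + (ε / 3 + ε / 3) := add_lt_add t1 (add_lt_add h4 hx1)
    _ = ε := by ring

/-! ## 4. The composition: the registered stubs imply the crux, BY NAME -/

/-- **`ExcursionInitialValue_of` (kernel-checked, no `sorry` here): InteriorRatioLimit → PoleHarnack →
`SAWSteinDefect.ExcursionInitialValue`.**  The crux's `q_0(δ) = H'([a_δ]; a_δ)/H([a_δ]; a_δ)` is
`exRatio D D' a b δ (a δ)` by definitional unfolding of its `let H`, `let H'`; conclude with
`tendsto_exRatio_pole`. -/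
theorem ExcursionInitialValue_of (h1 : Registered.stub_interiorRatio) (h2 : Registered.stub_poleHarnack) :
    ExcursionInitialValue := by
  intro D D' a b
  dsimp only
  intro hab hsub hp0 hp1 hball φ hφ Φ d hΦ hd
  exact tendsto_exRatio_pole h1 h2 D D' a b hab hsub hp0 hp1 hball φ hφ Φ d hΦ hd

/-- Hypothesis-free form: the crux modulo the two sorried stubs. -/
example : ExcursionInitialValue := ExcursionInitialValue_of stub_interiorRatio stub_poleHarnack

/-- The conclusion is literally the route decl (FQ name). -/
example (h1 : Registered.stub_interiorRatio) (h2 : Registered.stub_poleHarnack) :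
    Summit.CriticalPhenomena.SAWScalingLimit.Theses.SAWSteinDefect.ExcursionInitialValue :=
  ExcursionInitialValue_of h1 h2

end Summit.CriticalPhenomena.SAWScalingLimit.Cruxes.ExcursionInitialValue.Birth

end
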